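import Mathlib
import Summits.Ventures.PercRepro2.Defs
import Summits.Ventures.PercRepro2.Independence
import Summits.Ventures.PercRepro2.Graph
import Summits.Ventures.PercRepro2.Induced
import Summits.Ventures.PercRepro2.HullDefs
import Summits.Ventures.PercRepro2.HullFlip
import Summits.Ventures.PercRepro2.HullTheoremA
import Summits.Ventures.PercRepro2.HullTree
import Summits.Ventures.PercRepro2.HullDownSet

/-!
# The down-set rows (DS)/(DSK) as Hall statements (blind cell PercRepro2, typer-1; lead g10
`LEAD-PROOFSHAPES.md` ADDENDUM 24 (23), (29); lead g11 ASSIGNMENTS v11.8 (2))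

On the free fibre the `+1` configurations of (BASE) are `P = {o ∈ R_side, h ∉ H_l, h ↔_B b}` and
the `−1` configurations `M = {o ∈ B_side, h ∉ H_l, h ↔_B b}` (`plusSet`, `minusSet`;
`sideSign_mul_outConn_eq`: `s_{o,l} · outConn = 1_P − 1_M`). For a "key" `κ : Config E → β` into a
preorder:

* `KeyRow κ`: for every down-set `𝒟 ⊆ β`, `Σ_{κ(ζ) ∈ 𝒟} s_{o,l} · outConn ≥ 0`;
  `KeyInjection κ`: an injection `M → P` with `κ(φ ζ) ≤ κ(ζ)`;
* **`keyRow_iff_keyInjection`** (marriage theorem): the two are equivalent — Hall's condition for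
  the relation `κ(ζ′) ≤ κ(ζ)` is exactly the down-set counting;
* **`DSRow_iff_exists_injective`**: row (DS) = an injection `M → P` that never enlarges the hull;
  **`DSKRow_iff_exists_injective`**: row (DSK) = an injection that enlarges neither the hull nor the
  core (the lead's sharpest Hall statement, ADDENDUM 24 (29)).
-/

namespace Summit.Ventures.PercRepro2

namespace Hull

open scoped Classical

variable {V : Type*} {E : Type*} [Fintype E] [DecidableEq E]
  {R : Type*} [Field R] [LinearOrder R] [IsStrictOrderedRing R]

/-! ## The two halves of (BASE) on the free fibre -/

/-- The `+1` configurations `{o ∈ R_side, h ∉ H_l, h ↔_B b}`. -/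
noncomputable def plusSet (ends : E → Sym2 V) (l o h b : V) : Finset (Config E) :=
  Finset.univ.filter fun ζ => o ∈ rside ends ζ l ∧ h ∉ hull ends ζ l ∧ Conn ends (blue ζ) h b

/-- The `−1` configurations `{o ∈ B_side, h ∉ H_l, h ↔_B b}`. -/
noncomputable def minusSet (ends : E → Sym2 V) (l o h b : V) : Finset (Config E) :=
  Finset.univ.filter fun ζ => o ∈ bside ends ζ l ∧ h ∉ hull ends ζ l ∧ Conn ends (blue ζ) h b

omit [LinearOrder R] [IsStrictOrderedRing R] in
/-- `s_{o,l} · outConn = 1_P − 1_M` pointwise. -/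
lemma sideSign_mul_outConn_eq (ends : E → Sym2 V) (l o h b : V) (ζ : Config E) :
    sideSign R ends ζ l o * outConn R ends l h b ζ =
      (if ζ ∈ plusSet ends l o h b then 1 else 0) - (if ζ ∈ minusSet ends l o h b then 1 else 0) := by
  unfold outConn plusSet minusSet
  simp only [Finset.mem_filter, Finset.mem_univ, true_and]
  by_cases hR : o ∈ rside ends ζ l
  · have hB : o ∉ bside ends ζ l := fun hB => rside_disjoint_bside ζ l o hR hB
    rw [sideSign_eq_one hR]
    by_cases hh : h ∉ hull ends ζ l <;> by_cases hc : Conn ends (blue ζ) h b <;> simp [hR, hB, hh, hc]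
  · by_cases hB : o ∈ bside ends ζ l
    · rw [sideSign_eq_neg_one hB]
      by_cases hh : h ∉ hull ends ζ l <;> by_cases hc : Conn ends (blue ζ) h b <;>
        simp [hR, hB, hh, hc]
    · rw [sideSign_eq_zero hR hB]
      simp [hR, hB]

omit [LinearOrder R] [IsStrictOrderedRing R] in
/-- A restricted sum of `s_{o,l} · outConn` counts `|P ∩ pred| − |M ∩ pred|`. -/
lemma sum_sideSign_outConn_eq_card (ends : E → Sym2 V) (l o h b : V) (pred : Config E → Prop)
    [DecidablePred pred] :
    (∑ ζ : Config E, if pred ζ then sideSign R ends ζ l o * outConn R ends l h b ζ else 0) =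
      (((plusSet ends l o h b).filter pred).card : R) -
        ((minusSet ends l o h b).filter pred).card := by
  have hgen : ∀ S : Finset (Config E), ((S.filter pred).card : R) =
      ∑ ζ : Config E, if ζ ∈ S ∧ pred ζ then 1 else 0 := by
    intro S
    rw [Finset.card_filter, Nat.cast_sum, ← Finset.univ_inter S, ← Finset.sum_ite_mem,
      Finset.univ_inter]
    refine Finset.sum_congr rfl fun ζ _ => ?_
    by_cases h1 : ζ ∈ S <;> by_cases h2 : pred ζ <;> simp [h1, h2]
  have hP := hgen (plusSet ends l o h b)
  have hM := hgen (minusSet ends l o h b)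
  rw [hP, hM, ← Finset.sum_sub_distrib]
  refine Finset.sum_congr rfl fun ζ _ => ?_
  rw [sideSign_mul_outConn_eq]
  by_cases hp : pred ζ <;> simp [hp]

/-! ## Key rows and key injections -/

section Key

variable {β : Type*} [Preorder β]

/-- The down-set row for the key `κ`: every down-set of keys carries a nonnegative sum. -/
def KeyRow (R : Type*) [Ring R] [LinearOrder R] (ends : E → Sym2 V) (l o h b : V)
    (κ : Config E → β) : Prop :=
  ∀ 𝒟 : Set β, IsLowerSet 𝒟 →
    0 ≤ ∑ ζ : Config E, if κ ζ ∈ 𝒟 then sideSign R ends ζ l o * outConn R ends l h b ζ else 0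

/-- The `+1` configurations whose key is below `κ(ζ)`. -/
noncomputable def keyTargets (ends : E → Sym2 V) (l o h b : V) (κ : Config E → β) (ζ : Config E) :
    Finset (Config E) :=
  (plusSet ends l o h b).filter fun ζ' => κ ζ' ≤ κ ζ

/-- A key injection: an injection `M → P` that never raises the key. -/
def KeyInjection (ends : E → Sym2 V) (l o h b : V) (κ : Config E → β) : Prop :=
  ∃ f : {ζ // ζ ∈ minusSet ends l o h b} → Config E,
    Function.Injective f ∧ ∀ x, f x ∈ keyTargets ends l o h b κ x.1

/-- The down-set row gives Hall's condition for the key relation. -/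
lemma hall_of_keyRow (ends : E → Sym2 V) (l o h b : V) (κ : Config E → β)
    (hr : KeyRow R ends l o h b κ) (s : Finset {ζ // ζ ∈ minusSet ends l o h b}) :
    s.card ≤ (s.biUnion fun x => keyTargets ends l o h b κ x.1).card := by
  -- the down-set generated by the keys of `s`
  obtain ⟨𝒟, h𝒟⟩ : ∃ 𝒟 : Set β, 𝒟 = {k | ∃ x ∈ s, k ≤ κ x.1} := ⟨_, rfl⟩
  have hlow : IsLowerSet 𝒟 := by
    rw [h𝒟]
    exact fun _ _ hle ⟨x, hx, hk⟩ => ⟨x, hx, hle.trans hk⟩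
  have key := hr 𝒟 hlow
  have hsum := sum_sideSign_outConn_eq_card (R := R) ends l o h b (fun ζ => κ ζ ∈ 𝒟)
  have key' : ((minusSet ends l o h b).filter fun ζ => κ ζ ∈ 𝒟).card ≤
      ((plusSet ends l o h b).filter fun ζ => κ ζ ∈ 𝒟).card :=
    Nat.cast_le (α := R) |>.1 (sub_nonneg.1 (le_of_le_of_eq key hsum))
  -- `s` injects into `M ∩ 𝒟`
  have h1 : s.card ≤ ((minusSet ends l o h b).filter fun ζ => κ ζ ∈ 𝒟).card := by
    refine Finset.card_le_card_of_injOn Subtype.val (fun x hx => ?_)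
      (fun x _ y _ hxy => Subtype.ext hxy)
    exact Finset.mem_filter.2 ⟨x.2, by rw [h𝒟]; exact ⟨x, hx, le_rfl⟩⟩
  -- the targets of `s` are exactly `P ∩ 𝒟`
  have h2 : (s.biUnion fun x => keyTargets ends l o h b κ x.1) =
      (plusSet ends l o h b).filter fun ζ => κ ζ ∈ 𝒟 := by
    ext ζ
    simp only [Finset.mem_biUnion, keyTargets, Finset.mem_filter, h𝒟, Set.mem_setOf_eq]
    constructor
    · rintro ⟨x, hx, hP, hle⟩
      exact ⟨hP, x, hx, hle⟩
    · rintro ⟨hP, x, hx, hle⟩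
      exact ⟨x, hx, hP, hle⟩
  rw [h2]
  exact h1.trans key'

/-- Hall's condition for the key relation gives the down-set row. -/
lemma keyRow_of_hall (ends : E → Sym2 V) (l o h b : V) (κ : Config E → β)
    (hh : ∀ s : Finset {ζ // ζ ∈ minusSet ends l o h b},
      s.card ≤ (s.biUnion fun x => keyTargets ends l o h b κ x.1).card) :
    KeyRow R ends l o h b κ := by
  intro 𝒟 h𝒟
  have hsum := sum_sideSign_outConn_eq_card (R := R) ends l o h b (fun ζ => κ ζ ∈ 𝒟)
  refine le_of_le_of_eq (sub_nonneg.2 ?_) hsum.symm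
  -- the `−1` configurations with key in `𝒟`, as a set of indices
  set s : Finset {ζ // ζ ∈ minusSet ends l o h b} := Finset.univ.filter fun x => κ x.1 ∈ 𝒟 with hs
  have h1 : ((minusSet ends l o h b).filter fun ζ => κ ζ ∈ 𝒟).card ≤ s.card := by
    refine Finset.card_le_card_of_surjOn Subtype.val fun ζ hζ => ?_
    have hm := (Finset.mem_filter.1 hζ).1
    have hk := (Finset.mem_filter.1 hζ).2
    exact ⟨⟨ζ, hm⟩, Finset.mem_filter.2 ⟨Finset.mem_univ _, hk⟩, rfl⟩
  have h2 : (s.biUnion fun x => keyTargets ends l o h b κ x.1) ⊆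
      (plusSet ends l o h b).filter fun ζ => κ ζ ∈ 𝒟 := by
    intro ζ hζ
    obtain ⟨x, hx, hζ⟩ := Finset.mem_biUnion.1 hζ
    have hxD : κ x.1 ∈ 𝒟 := (Finset.mem_filter.1 hx).2
    have hP := Finset.mem_filter.1 hζ
    exact Finset.mem_filter.2 ⟨hP.1, h𝒟 hP.2 hxD⟩
  exact Nat.cast_le.2 ((h1.trans (hh s)).trans (Finset.card_le_card h2))

/-- **Marriage theorem for a key row**: the down-set counting form is equivalent to the existence
of a key-non-increasing injection `M → P`. -/
theorem keyRow_iff_keyInjection (ends : E → Sym2 V) (l o h b : V) (κ : Config E → β) :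
    KeyRow R ends l o h b κ ↔ KeyInjection ends l o h b κ := by
  constructor
  · intro hr
    exact (Finset.all_card_le_biUnion_card_iff_exists_injective _).1 (hall_of_keyRow ends l o h b κ hr)
  · intro hi
    exact keyRow_of_hall ends l o h b κ
      ((Finset.all_card_le_biUnion_card_iff_exists_injective _).2 hi)

end Key

/-! ## Rows (DS) and (DSK) as injections -/

omit [IsStrictOrderedRing R] in
/-- Row (DS) is the key row of the hull. -/
lemma DSRow_iff_keyRow (ends : E → Sym2 V) (l o h b : V) :
    DSRow R ends l o h b ↔ KeyRow R ends l o h b (fun ζ => hull ends ζ l) := Iff.rfl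

omit [IsStrictOrderedRing R] in
/-- Row (DSK) is the key row of the pair `(hull, core)`. -/
lemma DSKRow_iff_keyRow (ends : E → Sym2 V) (l o h b : V) :
    DSKRow R ends l o h b ↔ KeyRow R ends l o h b (fun ζ => (hull ends ζ l, core ends ζ l)) :=
  Iff.rfl

/-- **Row (DS) = a hull-non-enlarging injection `M → P`** (ADDENDUM 24 (23)). -/
theorem DSRow_iff_exists_injective (ends : E → Sym2 V) (l o h b : V) :
    DSRow R ends l o h b ↔
      ∃ f : {ζ // ζ ∈ minusSet ends l o h b} → Config E, Function.Injective f ∧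
        ∀ x, f x ∈ plusSet ends l o h b ∧ hull ends (f x) l ⊆ hull ends x.1 l := by
  rw [DSRow_iff_keyRow, keyRow_iff_keyInjection]
  unfold KeyInjection keyTargets
  simp only [Finset.mem_filter]

/-- **Row (DSK) = an injection `M → P` enlarging neither the hull nor the core** (ADDENDUM 24 (29),
the sharpest Hall statement). -/
theorem DSKRow_iff_exists_injective (ends : E → Sym2 V) (l o h b : V) :
    DSKRow R ends l o h b ↔
      ∃ f : {ζ // ζ ∈ minusSet ends l o h b} → Config E, Function.Injective f ∧
        ∀ x, f x ∈ plusSet ends l o h b ∧ hull ends (f x) l ⊆ hull ends x.1 l ∧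
          core ends (f x) l ⊆ core ends x.1 l := by
  rw [DSKRow_iff_keyRow, keyRow_iff_keyInjection]
  unfold KeyInjection keyTargets
  simp only [Finset.mem_filter, Prod.mk_le_mk]

end Hull

end Summit.Ventures.PercRepro2
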